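import Summits.CriticalPhenomena.PercolationContinuityZ3.Theorems.PercNearOneGluingNoHeavyQuantCornerTheorem
import HarnessLib

/-!
# QUANT lane R8, T-DEC: the CORNER IDENTITY — the corner run at a lower layer `λ ≤ j′` coincides with the corner run at `j′` on every pair
# `(l, h ≤ λ)` (LEAD-NOTES-G23 N50 (1))

builds on p205010 (kernel theorem, internal audit signed; external expert review pending)

Support file (`--supports stmt-CriticalPhenomena-4575`), QUANT lane lead seat prim-quant-lead (gen 23), rung R8 of
`run/shared/lean/prim/quant/LADDER.md`.  Theorems only; standard axioms, no sorries.  Uses the typer's corner run (`…QuantCornerRun`,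
`…QuantCornerSound`: `cornerFlow_inv`, `cornerPair_index`; `…QuantCornerTheorem`: `cornerPair_of_index`, `cornerIndex_lt_of_lt`).

THE IDENTITY.  For `0 < x < 1`, a nonnegative law `μ`, target `T` and layers `λ ≤ j′`:
  `cornerMidFlow x T λ M μ l h = cornerMidFlow x T j′ M μ l h`  for all `l ≤ λ`, `h ≤ λ`  (`cornerMidFlow_restrict`),
hence `cornerLeftover x T λ M μ l = cornerLeftover x T j′ M μ l + Σ_{λ < h ≤ M} cornerMidFlow x T j′ M μ l h` for `l ≤ λ`
(`cornerLeftover_restrict`): the lower layer's giant-bound mass of a low is the upper layer's flow into the mids in `(λ, j′]` plus its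
giant-bound mass.  WHY: if some low of `(T, j′)` lies above `λ` there is no mid `≤ λ` at all (`2h ≤ 2λ < 2k′ < T`); otherwise the `λ`-run is the
stage-subsequence `(l ≤ λ, h ≤ λ)` of the `j′`-run and the omitted stages touch no column `≤ λ` before it is final.  The proof goes through a
stage-free CHARACTERISATION of the corner values (`cornerMidFlow_char`: `V(l,h) = min(μ_l − Σ_{h′<h} V(l,h′), (μ_h − Σ_{l′>l} u·V(l′,h))/u)` on
admissible pairs, `0` elsewhere) and a strong induction along the run.
CONSEQUENCE for the law-level programme (README V264): with `decAtT_iff_cornerSucceeds` the hypothesis pair `DEC(T, j′) ∧ DEC(T, λ*)` of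
Conjecture SL-λ* is ONE canonical flow (the corner flow at `j′`) plus ONE scalar inequality; the two layers never hold competing budgets on a
mid `≤ λ*` (exact check before the proof: prim-quant-lead-g23/explore/g23_corner_identity.py, 3 000 / 3 000).

[this work]; corner rules for Monge transportation arrays are classical (Hoffman 1963); nothing here is cited as a published result.  The
gluing rows served [cite: KozmaNitzan2024, Conjecture 3 (p. 15)]; product measure [cite: Grimmett1999, §1.3 p. 10].
-/

noncomputable section

namespace Summit.CriticalPhenomena.PercolationContinuityZ3.Theorems

namespace Quant

open Finset

namespace LawDec

section Restrict

variable (x T : ℝ) (j' M : ℕ) (μ : ℕ → ℝ)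

/-- the usage of a non-giant pair does not depend on the layer. -/
theorem usage_eq_of_le_layer (J J' l h : ℕ) (hJ : h ≤ J) (hJ' : h ≤ J') : usage x T J l h = usage x T J' l h := by
  unfold usage gateOf
  rw [if_neg (by omega), if_neg (by omega)]

/-- **later stages do not touch a pair**: for `N = (j′−l)(j′+1) + h` and `N + 1 ≤ n ≤ (j′+1)²`, the entry `(l,h)` of stage `n` is that of
stage `N + 1`. -/
theorem cornerFlow_stable (l h : ℕ) (n : ℕ)
    (hn1 : (j' - l) * (j' + 1) + h + 1 ≤ n) (hn2 : n ≤ (j' + 1) * (j' + 1)) :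
    cornerFlow x T j' M μ n l h = cornerFlow x T j' M μ ((j' - l) * (j' + 1) + h + 1) l h := by
  induction n with
  | zero => omega
  | succ n ih =>
    rcases Nat.eq_or_lt_of_le hn1 with heq | hlt
    · rw [heq]
    · rw [cornerFlow_succ, cornerUpdate_apply_of_ne, ih (by omega) (by omega)]
      by_contra hne
      push Not at hne
      have hidx := cornerPair_index j' n (by omega)
      rw [← hne.1, ← hne.2] at hidx
      omega

/-- **earlier stages have not touched a pair**: for `n ≤ N = (j′−l)(j′+1) + h` (`n ≤ (j′+1)²`) the entry `(l,h)` of stage `n` is `0`. -/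
theorem cornerFlow_before (hx0 : 0 < x) (hx1 : x < 1) (hμ : ∀ k, 0 ≤ μ k) (l h n : ℕ)
    (hn : n ≤ (j' - l) * (j' + 1) + h) (hn2 : n ≤ (j' + 1) * (j' + 1)) :
    cornerFlow x T j' M μ n l h = 0 := by
  by_contra hne
  obtain ⟨-, hsup, -, -⟩ := cornerFlow_inv x T j' M μ hx0 hx1 hμ n hn2
  have := (hsup l h hne).2.2.2.2.2
  omega

/-- entries of the final corner flow off `{l ≤ j′} × {h ≤ j′}` vanish. -/
theorem cornerMidFlow_eq_zero_of (hx0 : 0 < x) (hx1 : x < 1) (hμ : ∀ k, 0 ≤ μ k) (l h : ℕ) (hlh : j' < l ∨ j' < h) :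
    cornerMidFlow x T j' M μ l h = 0 := by
  by_contra hne
  obtain ⟨-, hsup, -, -⟩ := cornerFlow_inv x T j' M μ hx0 hx1 hμ ((j' + 1) * (j' + 1)) le_rfl
  obtain ⟨h1, h2, -⟩ := hsup l h hne
  omega

/-- **STAGE-FREE CHARACTERISATION OF THE CORNER VALUES** (`l ≤ j′`, `h ≤ j′`): on an admissible pair the final value is
`min(μ_l − Σ_{h′ < h} V(l,h′), (μ_h − Σ_{l′ > l} u(l′,h)·V(l′,h)) / u(l,h))`, and `0` on an inadmissible one. [this work] -/
theorem cornerMidFlow_char (hx0 : 0 < x) (hx1 : x < 1) (hμ : ∀ k, 0 ≤ μ k) (l h : ℕ) (hl : l ≤ j') (hh : h ≤ j') :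
    cornerMidFlow x T j' M μ l h =
      if 2 * (l : ℝ) < T ∧ h ≤ M ∧ T < (l : ℝ) + h then
        min (μ l - ∑ h' ∈ Finset.range (M + 1), (if h' < h then cornerMidFlow x T j' M μ l h' else 0))
          ((μ h - ∑ l' ∈ Finset.range (j' + 1),
              (if l < l' then usage x T j' l' h * cornerMidFlow x T j' M μ l' h else 0)) / usage x T j' l h)
      else 0 := by
  set N := (j' - l) * (j' + 1) + h with hN
  have hNlt : N < (j' + 1) * (j' + 1) := by
    have := Nat.mul_le_mul_right (j' + 1) (show j' - l ≤ j' by omega)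
    simp only [hN]; nlinarith
  -- the final value is the value right after stage N
  have e0 : cornerMidFlow x T j' M μ l h = cornerFlow x T j' M μ (N + 1) l h := by
    unfold cornerMidFlow
    exact cornerFlow_stable x T j' M μ l h ((j' + 1) * (j' + 1)) (by omega) le_rfl
  rw [e0, cornerFlow_succ, cornerPair_of_index j' l h N hl hh rfl]
  -- the row sum at stage N: entries (l, h′) with h′ < h are final, the others are 0
  have erow : ∑ h' ∈ Finset.range (M + 1), cornerFlow x T j' M μ N l h'
      = ∑ h' ∈ Finset.range (M + 1), (if h' < h then cornerMidFlow x T j' M μ l h' else 0) := by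
    refine Finset.sum_congr rfl fun h' _ => ?_
    by_cases hlt : h' < h
    · rw [if_pos hlt]
      have h'j : h' ≤ j' := by omega
      rw [cornerFlow_stable x T j' M μ l h' N (by simp only [hN]; omega) hNlt.le]
      unfold cornerMidFlow
      rw [cornerFlow_stable x T j' M μ l h' ((j' + 1) * (j' + 1)) (by
        have := Nat.mul_le_mul_right (j' + 1) (show j' - l ≤ j' by omega); nlinarith) le_rfl]
    · rw [if_neg hlt]
      by_cases h'j : h' ≤ j'
      · exact cornerFlow_before x T j' M μ hx0 hx1 hμ l h' N (by simp only [hN]; omega) hNlt.le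
      · by_contra hne
        obtain ⟨-, hsup, -, -⟩ := cornerFlow_inv x T j' M μ hx0 hx1 hμ N hNlt.le
        exact h'j (hsup l h' hne).2.1
  -- the column sum at stage N: entries (l′, h) with l′ > l are final, the others are 0
  have ecol : ∑ l' ∈ Finset.range (j' + 1), usage x T j' l' h * cornerFlow x T j' M μ N l' h
      = ∑ l' ∈ Finset.range (j' + 1), (if l < l' then usage x T j' l' h * cornerMidFlow x T j' M μ l' h else 0) := by
    refine Finset.sum_congr rfl fun l' hl' => ?_
    have hl'j : l' ≤ j' := Nat.lt_succ_iff.1 (Finset.mem_range.1 hl')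
    by_cases hlt : l < l'
    · rw [if_pos hlt]
      have hidx := cornerIndex_lt_of_lt j' l l' h h hlt hl'j hh
      rw [cornerFlow_stable x T j' M μ l' h N (by simp only [hN]; omega) hNlt.le]
      unfold cornerMidFlow
      rw [cornerFlow_stable x T j' M μ l' h ((j' + 1) * (j' + 1)) (by
        have := Nat.mul_le_mul_right (j' + 1) (show j' - l' ≤ j' by omega); nlinarith) le_rfl]
    · rw [if_neg hlt]
      have hle : (j' - l) * (j' + 1) + h ≤ (j' - l') * (j' + 1) + h := by
        have := Nat.mul_le_mul_right (j' + 1) (show j' - l ≤ j' - l' by omega); omega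
      rw [cornerFlow_before x T j' M μ hx0 hx1 hμ l' h N (by simp only [hN]; omega) hNlt.le, mul_zero]
  by_cases hadm : 2 * (l : ℝ) < T ∧ h ≤ M ∧ T < (l : ℝ) + h
  · rw [if_pos hadm, cornerUpdate_apply_self x T j' M μ _ l h hadm.1 hadm.2.1 hadm.2.2, erow, ecol]
  · rw [if_neg hadm, cornerUpdate_of_not_admissible x T j' M μ _ (l, h) hadm]
    exact cornerFlow_before x T j' M μ hx0 hx1 hμ l h N le_rfl hNlt.le

/-- **THE CORNER IDENTITY**: for `λ ≤ j′` the corner runs at layers `λ` and `j′` agree on every pair `(l ≤ λ, h ≤ λ)`. [this work] -/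
theorem cornerMidFlow_restrict (lam : ℕ) (hx0 : 0 < x) (hx1 : x < 1) (hμ : ∀ k, 0 ≤ μ k) (hlam : lam ≤ j') :
    ∀ l h, l ≤ lam → h ≤ lam → cornerMidFlow x T lam M μ l h = cornerMidFlow x T j' M μ l h := by
  -- strong induction on the λ-stage index
  suffices H : ∀ n : ℕ, ∀ l h, l ≤ lam → h ≤ lam → (lam - l) * (lam + 1) + h = n →
      cornerMidFlow x T lam M μ l h = cornerMidFlow x T j' M μ l h by
    intro l h hl hh; exact H _ l h hl hh rfl
  intro n
  induction n using Nat.strong_induction_on with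
  | _ n ih =>
    intro l h hl hh hidx
    rw [cornerMidFlow_char x T lam M μ hx0 hx1 hμ l h hl hh,
      cornerMidFlow_char x T j' M μ hx0 hx1 hμ l h (hl.trans hlam) (hh.trans hlam)]
    by_cases hadm : 2 * (l : ℝ) < T ∧ h ≤ M ∧ T < (l : ℝ) + h
    · rw [if_pos hadm, if_pos hadm]
      -- row sums agree term by term (pairs (l, h′ < h) come earlier)
      have erow : ∑ h' ∈ Finset.range (M + 1), (if h' < h then cornerMidFlow x T lam M μ l h' else 0)
          = ∑ h' ∈ Finset.range (M + 1), (if h' < h then cornerMidFlow x T j' M μ l h' else 0) := by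
        refine Finset.sum_congr rfl fun h' _ => ?_
        by_cases hlt : h' < h
        · rw [if_pos hlt, if_pos hlt, ih ((lam - l) * (lam + 1) + h') (by omega) l h' hl (by omega) rfl]
        · rw [if_neg hlt, if_neg hlt]
      -- column sums: lows l′ ≤ λ by induction, lows in (λ, j′] are never compatible with h ≤ λ
      have ecol : ∑ l' ∈ Finset.range (lam + 1),
            (if l < l' then usage x T lam l' h * cornerMidFlow x T lam M μ l' h else 0)
          = ∑ l' ∈ Finset.range (j' + 1),
            (if l < l' then usage x T j' l' h * cornerMidFlow x T j' M μ l' h else 0) := by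
        rw [← Finset.sum_subset (Finset.range_mono (show lam + 1 ≤ j' + 1 by omega))
          (f := fun l' => if l < l' then usage x T j' l' h * cornerMidFlow x T j' M μ l' h else 0)]
        · refine Finset.sum_congr rfl fun l' hl' => ?_
          have hl'lam : l' ≤ lam := Nat.lt_succ_iff.1 (Finset.mem_range.1 hl')
          by_cases hlt : l < l'
          · rw [if_pos hlt, if_pos hlt, usage_eq_of_le_layer x T lam j' l' h hh (hh.trans hlam),
              ih ((lam - l') * (lam + 1) + h) ?_ l' h hl'lam hh rfl]
            rw [← hidx]
            exact cornerIndex_lt_of_lt lam l l' h h hlt hl'lam hh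
          · rw [if_neg hlt, if_neg hlt]
        · intro l' hl'j hnl'
          rw [Finset.mem_range] at hl'j hnl'
          split_ifs with hlt
          · -- l′ ∈ (λ, j′]: the pair (l′, h) is inadmissible, so its corner value is 0
            rw [cornerMidFlow_char x T j' M μ hx0 hx1 hμ l' h (by omega) (hh.trans hlam), if_neg, mul_zero]
            rintro ⟨hlow', -, hcomp'⟩
            have : (h : ℝ) ≤ lam := by exact_mod_cast hh
            have : (lam : ℝ) + 1 ≤ l' := by exact_mod_cast (show lam + 1 ≤ l' by omega)
            linarith
          · rfl
      rw [erow, ecol, usage_eq_of_le_layer x T lam j' l h hh (hh.trans hlam)]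
    · rw [if_neg hadm, if_neg hadm]

/-- **the lower layer's giant-bound mass** of a low `l ≤ λ`: `leftover_λ(l) = leftover_j′(l) + Σ_{λ < h ≤ M} V_j′(l, h)`. [this work] -/
theorem cornerLeftover_restrict (lam : ℕ) (hx0 : 0 < x) (hx1 : x < 1) (hμ : ∀ k, 0 ≤ μ k) (hlam : lam ≤ j') (l : ℕ) (hl : l ≤ lam) :
    cornerLeftover x T lam M μ l = cornerLeftover x T j' M μ l
      + ∑ h ∈ Finset.range (M + 1), (if lam < h then cornerMidFlow x T j' M μ l h else 0) := by
  unfold cornerLeftover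
  have e : ∀ h ∈ Finset.range (M + 1), cornerMidFlow x T lam M μ l h
      = cornerMidFlow x T j' M μ l h - (if lam < h then cornerMidFlow x T j' M μ l h else 0) := by
    intro h _
    by_cases hlt : lam < h
    · rw [if_pos hlt, cornerMidFlow_eq_zero_of x T lam M μ hx0 hx1 hμ l h (Or.inr hlt)]; ring
    · rw [if_neg hlt, cornerMidFlow_restrict x T j' M μ lam hx0 hx1 hμ hlam l h hl (by omega)]; ring
  rw [Finset.sum_congr rfl e, Finset.sum_sub_distrib]
  ring

end Restrict

end LawDec

end Quant

end Summit.CriticalPhenomena.PercolationContinuityZ3.Theorems
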